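import Summits.QuantumFields.BalabanUV.Beta.EriceFlowEnclosureB12AsPrintedHistoryNonuniqueForward
import Summits.QuantumFields.BalabanUV.Beta.EriceFlowEnclosureB12AsPrintedHistoryJumpEnd

/-!
# Beta / EriceFlowEnclosureB12AsPrintedHistoryNonuniqueSetting — THE NON-UNIQUENESS WITNESS AS A `Setting` OF THE AS-PRINTED INTERFACE:
# `StandingHypotheses ∧ Definitions ∧ Conclusions` (so `B12BetaAsPrinted S`), Theorem 2 AS PRINTED (`Theorem2Statement`), `BetaPertH`, the
# AF letters, (C), a UNIFORM history modulus (`FadingMemory C 1 Λ`) — and TWO DISTINCT BARE COUPLINGS whose Theorem-3 runs (`RunHyp`) of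
# the same depth end at the SAME renormalized coupling.  #61e's `bareCoupling_unique_of_fadingMemory` READ AT θ = 1 is FALSE on the carrier,
# print + Theorem 2 + the wall letter notwithstanding (β-flow team, prover 1 = recursion ∕ upper ∕ bare-coupling ∕ UNIQUENESS side, unit
# `b2b-balaban-beta-bflow-p1`, gen 34; ROW AP-I·C × ROW U; the END of gen 34's witness chain `…HistoryNonunique` → `…Runs` → `…End` → `…Forward`)

HONEST FRAMING (page 1 of everything the β sub-cell writes): discharging `BetaPertH` makes Bałaban's UV stability UNCONDITIONAL — a
real constructive-QFT result; it is NOT the continuum limit and NOT the Clay problem.  HONEST DEPENDENCY (cell reorg 2026-08-19,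
verbatim): «continuum YM on T⁴ ⇐ BetaPertH ∧ nine spine estimates (0/9 proved); BetaPertH ⇐ (D1) ∧ (D4) ∧ CAP+tail; G-an2-4 gates
asym, D1 and NE2/3/4.»  THIS MODULE DISCHARGES NOTHING: it builds ONE TOY SETTING OF OURS of the statement-exact typing of [I] = T. Bałaban,
Commun. Math. Phys. **109** (1987) [Balaban1987RG1] (`B12BetaAsPrinted`, typer unit `b2b-balaban-beta-asprinted`, p537882 ✓ … v1.3 p562908 ✓)
INSIDE AN EXISTENCE PROOF (def-free), with the toolkit of #60d `…B12AsPrintedWitness` (the transposed marginal kernel c·Re Qᵀ: (1.22) both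
members, (5.10), (5.7), (5.37)–(5.38) with (5.44)) exactly as #61c `histJumpToy_exists` did.  The toy is OURS ([folklore]); nothing of
Bałaban's β_{j+1}, Π_{j+1} or of [I]'s claims is asserted; no toy is claimed to resemble the construction; Theorem 2 is STATED WITHOUT
PROOF in print (p. 259) and enters here only because the toy's letters imply it by #60a `theorem2Statement_of_letters`.  READ THIS TWICE
(an4 WORD-62): for the toy THEOREM 2 AS PRINTED HOLDS — *"there exists a bare coupling constant g₀ = g₀(ε, g)"* is EXISTENCE written in function
NOTATION, and existence holds here —; what FAILS is UNIQUENESS (∃!), which print does not assert.  The toy is NOT a counterexample to Theorem 2;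
it is a counterexample to reading the notation «g₀(ε, g)» as a function WITHOUT a decaying (or Markov) modulus in the preceding couplings.

THE TOY.  L = 13, Theorem 3's γ = the prescribed γ; one-loop part b from log Z (`logZ ≡ b`), interaction part
𝐄_int := 𝟙[n ≤ k < 2n]·ε·max(1 − |Σ_{i<n}(g_i − gᴮ_i)|∕M, 0)·χ(g_k) with χ(s) = smoothTransition(s∕τ) (vanishing at g_k = 0 — print's remark after
(2.13), `d213`; C^∞ in g_k — `c264`; = 1 along run B), β_{k+1} = b + 𝐄_int ((1.22) with Π := β·Re Qᵀ), runs = THE FORWARD TABLE of (0.20)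
(`…HistoryNonuniqueForward` §22: `d018`, `d020`), E₀ = b + 1, δ₁ = 1, C510 = MQ(1, 4), C544 = 1, the p. 266 flag OFF.  The data (n, x₀, ε, τ, L,
gᴬ, gᴮ, M) are `toyData_exists`'s, for PRESCRIBED b, C, C_p, γ, g.

WHAT THIS FILE PROVES (0 sorry, 0 def):
§25 `term_bounds` (0 ≤ 𝐄_int ≤ ε), **`nonuniqueToy_exists`** — for every b, C, C_p, γ > 0 and g ∈ ]0, γ]: ∃ S : Setting with `StandingHypotheses ∧
    Definitions ∧ Conclusions`, S.γ = γ, `Theorem2Statement S hL`, `BetaPertH S.β b`, `BetaLowerH b γ S.β`, `BetaUpperH (b + b) γ S.β`, `BetaContH γ S.β`,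
    `HistLipschitz Λ γ S.β` with `FadingMemory C 1 Λ`, and bare couplings g₀ ≠ g₀′ with `RunHyp S ⟨K, m, g₀⟩`, `RunHyp S ⟨K, m, g₀′⟩`, both runs
    ending at g_K = g;
§26 HEADLINE **`fadingMemory_loadBearing`**: #61e `bareCoupling_unique_of_fadingMemory` with `FadingMemory C θ Λ, θ < 1` + smallness replaced by the
    UNIFORM `FadingMemory C 1 Λ` is FALSE — even with `StandingHypotheses ∧ Conclusions ∧ Theorem2Statement ∧ BetaPertH ∧ BetaUpperH ∧ BetaContH`
    ADDED and for every value of (b, C).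
NOT CLAIMED: anything about Bałaban's β; that it lacks fading memory; Theorem 2; `BetaPertH` for Bałaban's β; continuum; Clay.
-/

namespace Summit.QuantumFields.BalabanUV.Beta.EriceFlowEnclosureB12AsPrintedHistoryNonuniqueSetting

open Finset
open Literature.MathematicalPhysics.QuantumFieldTheory.GawedzkiKupiainen1985.PeriodicGleason (Pt ExpBound)
open Literature.MathematicalPhysics.QuantumFieldTheory.Balaban1983to89
open Literature.MathematicalPhysics.QuantumFieldTheory.Balaban1983to89.B12Rep537 (wilsonQ MQ)
open Literature.MathematicalPhysics.QuantumFieldTheory.Balaban1983to89.B12BetaAsPrinted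
open Literature.MathematicalPhysics.QuantumFieldTheory.Balaban1983to89.FlowStep (HBeta prefixOf Box mem_box box_mono RGEqH BetaLowerH
  BetaUpperH BetaContH BetaPertH)
open Literature.MathematicalPhysics.QuantumFieldTheory.Balaban1983to89.T4CouplingMatching (HistLipschitz FadingMemory)
open Literature.MathematicalPhysics.QuantumFieldTheory.Balaban1983to89.B12CouplingClausesHistory (betaDerivsBoundedInLast264_of_smooth)
open Summit.QuantumFields.BalabanUV.Beta.EriceFlowEnclosureB12AsPrintedMarginal (wilsonQ_perm wilsonQ_neg_transpose)
open Summit.QuantumFields.BalabanUV.Beta.EriceFlowEnclosureB12AsPrintedUpper (theorem2Statement_of_letters)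
open Summit.QuantumFields.BalabanUV.Beta.EriceFlowEnclosureB12AsPrintedWitness (secondMoment_toyKernel fourier_toyKernel
  decay510_toyKernel reflect_toyKernel rep537_toyKernel)
open Summit.QuantumFields.BalabanUV.Beta.EriceFlowEnclosureB12AsPrintedLastVar (rep537_diag expBound_zero)
open Summit.QuantumFields.BalabanUV.Beta.EriceFlowEnclosureB12AsPrintedHistoryJumpEnd (sectionHist_last)
open Summit.QuantumFields.BalabanUV.Beta.EriceFlowEnclosureB12AsPrintedHistoryNonunique
open Summit.QuantumFields.BalabanUV.Beta.EriceFlowEnclosureB12AsPrintedHistoryNonuniqueRuns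
open Summit.QuantumFields.BalabanUV.Beta.EriceFlowEnclosureB12AsPrintedHistoryNonuniqueForward

noncomputable section

/-! ## §25 The toy setting -/

/-- Size bookkeeping for the interaction slot: 0 ≤ 𝟙[band]·ε·bump·χ ≤ ε (ε ≥ 0, M ≥ 0, 0 ≤ χ ≤ 1). [folklore] -/
theorem term_bounds {ε M b : ℝ} {n k : ℕ} {gB : ℕ → ℝ} {χ : ℝ → ℝ} (hε : 0 ≤ ε) (hM : 0 ≤ M) (hχ : ∀ s, 0 ≤ χ s ∧ χ s ≤ 1)
    (p : Fin (k + 1) → ℝ) :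
    0 ≤ (if n ≤ k ∧ k < 2 * n then
        ε * max (1 - |∑ i : Fin (k + 1), (if (i : ℕ) < n then p i - gB i else 0)| / M) 0 * χ (p (Fin.last k)) else 0) ∧
      (if n ≤ k ∧ k < 2 * n then
        ε * max (1 - |∑ i : Fin (k + 1), (if (i : ℕ) < n then p i - gB i else 0)| / M) 0 * χ (p (Fin.last k)) else 0) ≤ ε ∧
      |b + (if n ≤ k ∧ k < 2 * n then
        ε * max (1 - |∑ i : Fin (k + 1), (if (i : ℕ) < n then p i - gB i else 0)| / M) 0 * χ (p (Fin.last k)) else 0)| ≤ |b| + ε := by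
  have h1 := bump_mem_Icc (∑ i : Fin (k + 1), (if (i : ℕ) < n then p i - gB i else 0)) hM
  have h2 := hχ (p (Fin.last k))
  have hlo : 0 ≤ (if n ≤ k ∧ k < 2 * n then
      ε * max (1 - |∑ i : Fin (k + 1), (if (i : ℕ) < n then p i - gB i else 0)| / M) 0 * χ (p (Fin.last k)) else 0) := by
    split_ifs
    · exact mul_nonneg (mul_nonneg hε h1.1) h2.1
    · exact le_rfl
  have hhi : (if n ≤ k ∧ k < 2 * n then
      ε * max (1 - |∑ i : Fin (k + 1), (if (i : ℕ) < n then p i - gB i else 0)| / M) 0 * χ (p (Fin.last k)) else 0) ≤ ε := by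
    split_ifs
    · calc ε * max (1 - |∑ i : Fin (k + 1), (if (i : ℕ) < n then p i - gB i else 0)| / M) 0 * χ (p (Fin.last k))
          ≤ ε * 1 * 1 := mul_le_mul (mul_le_mul_of_nonneg_left h1.2 hε) h2.2 h2.1 (by positivity)
        _ = ε := by ring
    · exact hε
  exact ⟨hlo, hhi, (abs_add_le _ _).trans (by rw [abs_of_nonneg hlo]; linarith)⟩

/-- **THE NON-UNIQUENESS TOY SETTING.**  For every b > 0 (AF letter), C > 0 (uniform history modulus), C_p > 0 (`BetaPertH` constant), Theorem-3
box γ > 0 and renormalized coupling g ∈ ]0, γ] there is a `Setting S` with: `StandingHypotheses S ∧ Definitions S ∧ Conclusions S` (hence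
`B12BetaAsPrinted S`), S.γ = γ; [I] Theorem 2 AS PRINTED (`Theorem2Statement`); `BetaPertH S.β b`; `BetaLowerH b γ S.β`, `BetaUpperH (b + b) γ S.β`;
(C) `BetaContH γ S.β`; history moduli `HistLipschitz Λ γ S.β` with the UNIFORM bound `FadingMemory C 1 Λ` — and two DIFFERENT bare couplings g₀ ≠
g₀′ whose runs (K, m, g₀), (K, m, g₀′) satisfy Theorem 3's run hypothesis `RunHyp` (solve (0.20), stay in ]0, γ]) and END AT THE SAME g_K = g.
(β_{k+1} = b + 𝟙[n ≤ k < 2n]·ε·max(1 − |Σ_{i<n}(g_i − gᴮ_i)|∕M, 0)·smoothTransition(g_k∕τ); runs = the forward table of (0.20); Π := β·Re Qᵀ;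
data from `toyData_exists`.) [folklore] -/
theorem nonuniqueToy_exists {b C Cp γ g : ℝ} (hb : 0 < b) (hC : 0 < C) (hCp : 0 < Cp) (hγ : 0 < γ) (hg : 0 < g) (hgγ : g ≤ γ) :
    ∃ S : Setting, ∃ hH : StandingHypotheses S, Definitions S ∧ Conclusions S ∧ S.γ = γ ∧
      Theorem2Statement S (hL_of_standing hH) ∧ BetaPertH S.β b ∧ BetaLowerH b γ S.β ∧ BetaUpperH (b + b) γ S.β ∧ BetaContH γ S.β ∧
      (∃ Λ : ℕ → ℕ → ℝ, HistLipschitz Λ γ S.β ∧ FadingMemory C 1 Λ) ∧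
      ∃ (K m : ℕ) (g₀ g₀' : ℝ), g₀ ≠ g₀' ∧ RunHyp S ⟨K, m, g₀⟩ ∧ RunHyp S ⟨K, m, g₀'⟩ ∧
        S.cpl ⟨K, m, g₀⟩ K = g ∧ S.cpl ⟨K, m, g₀'⟩ K = g := by
  obtain ⟨n, x₀, ε, M, τ, L, gA, gB, -, -, hn1, hε0, hε1, hεb, hx, hx₀0, hA, hB, hM, hMpos, hεM, hL0, hεL, hτ0, hχB, hχL, hΔ54, hεA,
    hA0, hend⟩ := toyData_exists (γ := γ) hb hC hCp hg 0
  have hχ01 : ∀ s : ℝ, 0 ≤ (fun s : ℝ => Real.smoothTransition (s / τ)) s ∧ (fun s : ℝ => Real.smoothTransition (s / τ)) s ≤ 1 :=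
    fun s => smoothStep_mem_Icc τ s
  -- `Setting` fields in order: L, groupScope, ε₀, cpl, β, γ, M, κ, Cfg, one, logZ, Eint, Ebold, repr437, α₀, α₁, E₀, Mκ, pol, polIV, κ₀,
  -- indAss, ε₁, altCutoff266, logN2, δ₀, δ₁, C510, C544 (anonymous constructor).
  let βt : HBeta := fun k p => b + (if n ≤ k ∧ k < 2 * n then
      ε * max (1 - |∑ i : Fin (k + 1), (if (i : ℕ) < n then p i - gB i else 0)| / M) 0 *
        (fun s : ℝ => Real.smoothTransition (s / τ)) (p (Fin.last k)) else 0)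
  let tbl : ℝ → ℕ → ℕ → ℝ := fun g₀ => fun k => Nat.rec (motive := fun _ => ℕ → ℝ) (fun _ => g₀)
      (fun k t i => if i ≤ k then t i else 1 / Real.sqrt (1 / (t k) ^ 2 - βt k (fun j : Fin (k + 1) => t j))) k
  have hβ : ∀ (j : ℕ) (p : Fin (j + 1) → ℝ), βt j p = b + (if n ≤ j ∧ j < 2 * n then
      ε * max (1 - |∑ i : Fin (j + 1), (if (i : ℕ) < n then p i - gB i else 0)| / M) 0 *
        (fun s : ℝ => Real.smoothTransition (s / τ)) (p (Fin.last j)) else 0) := fun j p => rfl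
  have hcs : ∀ (g₀ : ℝ) (k i : ℕ), tbl g₀ (k + 1) i =
      if i ≤ k then tbl g₀ k i else 1 / Real.sqrt (1 / (tbl g₀ k k) ^ 2 - βt k (fun j : Fin (k + 1) => tbl g₀ k j)) := fun g₀ k i => rfl
  let S : Setting := ⟨13, True, 1, fun P k => tbl P.g0 k k, βt, γ, 1, 1, fun _ => Unit, fun _ => (), fun _ _ => b,
      fun k p _ => (if n ≤ k ∧ k < 2 * n then
        ε * max (1 - |∑ i : Fin (k + 1), (if (i : ℕ) < n then p i - gB i else 0)| / M) 0 *
          (fun s : ℝ => Real.smoothTransition (s / τ)) (p (Fin.last k)) else 0),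
      fun k p _ => βt k p, fun _ F E => |F ()| ≤ E, 1, 1, b + 1, fun _ => 1, fun _ F => fun μ ν x => F () * (wilsonQ ν μ x).re,
      fun k p => fun μ ν x => βt k p * (wilsonQ ν μ x).re, 1, fun _ _ => True, 1, False,
      fun k p => (if n ≤ k ∧ k < 2 * n then
        ε * max (1 - |∑ i : Fin (k + 1), (if (i : ℕ) < n then p i - gB i else 0)| / M) 0 *
          (fun s : ℝ => Real.smoothTransition (s / τ)) (p (Fin.last k)) else 0),
      1, 1, MQ 1 4, 1⟩
  have hH : StandingHypotheses S :=
    { hL := ⟨⟨6, rfl⟩, by show (11 : ℕ) < 13; norm_num⟩, hG := trivial, hκ₀ := by norm_num, hMκ := by norm_num, hγ := hγ,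
      hε₀ := by norm_num, hε₁ := by norm_num, hα₀ := by norm_num, hα₁ := by norm_num, hκ := le_rfl, hM := le_rfl }
  -- the size of the slots: 0 ≤ 𝐄_int ≤ ε ≤ 1, |β| ≤ b + 1
  have hsz : ∀ (k : ℕ) (p : Fin (k + 1) → ℝ), |βt k p| ≤ b + 1 ∧
      |(if n ≤ k ∧ k < 2 * n then
        ε * max (1 - |∑ i : Fin (k + 1), (if (i : ℕ) < n then p i - gB i else 0)| / M) 0 *
          (fun s : ℝ => Real.smoothTransition (s / τ)) (p (Fin.last k)) else 0)| ≤ b + 1 := by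
    intro k p
    have h := term_bounds (b := b) (n := n) (k := k) (gB := gB) hε0.le hMpos.le hχ01 p
    exact ⟨h.2.2.trans (by rw [abs_of_pos hb]; linarith), by rw [abs_of_nonneg h.1]; linarith⟩
  have hD : Definitions S := by
    refine { d018 := fun P => rfl, d020 := ?_, d13 := ?_, d213 := ?_, d214 := fun _ _ => rfl, d120 := fun _ _ => rfl,
             d120split := ?_, d121 := ?_, d122 := ?_ }
    · intro P k _ _ h
      exact fwd_d020 (β := βt) (c := tbl P.g0) (hcs P.g0) k h
    · intro j p U
      have h1 : S.Ebold j p U = S.Ebold j p (S.one (j + 1)) := rfl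
      have h2 : S.logZ j U = S.logZ j (S.one (j + 1)) := rfl
      have h3 : S.Eint j p U = S.Eint j p (S.one (j + 1)) := rfl
      rw [h1, h2, h3, sub_self, sub_self, sub_self, add_zero]
    · intro k p p' hp hp'
      show (fun _ : Unit => (if n ≤ k ∧ k < 2 * n then
          ε * max (1 - |∑ i : Fin (k + 1), (if (i : ℕ) < n then p i - gB i else 0)| / M) 0 *
            (fun s : ℝ => Real.smoothTransition (s / τ)) (p (Fin.last k)) else 0)) =
        fun _ : Unit => (if n ≤ k ∧ k < 2 * n then
          ε * max (1 - |∑ i : Fin (k + 1), (if (i : ℕ) < n then p' i - gB i else 0)| / M) 0 *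
            (fun s : ℝ => Real.smoothTransition (s / τ)) (p' (Fin.last k)) else 0)
      simp only [hp, hp', zero_div, Real.smoothTransition.zero, mul_zero, ite_self]
    · intro j p; funext μ ν x; simp only [Pi.add_apply]; ring
    · intro k p
      refine ⟨fun σ μ ν x => congrArg (fun r : ℝ => βt k p * r) (congrArg Complex.re (wilsonQ_perm σ ν μ x)),
        fun ε' hε' μ ν z => reflect_toyKernel _ hε' μ ν z,
        fun μ ν z => congrArg (fun r : ℝ => βt k p * r) (congrArg Complex.re (wilsonQ_neg_transpose ν μ z).symm)⟩
    · intro j p _ μ ν hμν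
      exact ⟨(fourier_toyKernel hμν _).symm, (secondMoment_toyKernel hμν _).symm⟩
  have hSm := betaSmoothInLast264_of_bumpFamily (β := βt) hβ γ
  have hCo : Conclusions S := by
    refine { c13 := fun _ _ _ _ => trivial, c118 := fun P _ j _ s hs => ⟨?_, ?_⟩, c264 := ?_, c510 := ?_, c537 := ?_ }
    · exact (hsz j _).1
    · exact (hsz j _).2
    · intro P hP j hj
      exact ⟨fun m => smooth264_of_box hSm hP.inInterval hj m, fun h => h.elim,
        fun m => derivBound264_of_box (betaDerivsBoundedInLast264_of_smooth hγ hSm) hP.inInterval hj m⟩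
    · refine ⟨by norm_num, fun j F E hF μ ν x => ?_⟩
      have hF' : |F ()| ≤ E := hF
      have hd := decay510_toyKernel (d := 4) (F ()) μ ν x
      have hMQ := B12Rep537.MQ_nonneg 1 4
      show |F () * (wilsonQ ν μ x).re| ≤ MQ 1 4 * E * Real.exp (-1 * B12Sec2to5.l1 x)
      calc |F () * (wilsonQ ν μ x).re| ≤ |F ()| * MQ 1 4 * Real.exp (-1 * B12Sec2to5.l1 x) := hd
        _ ≤ E * MQ 1 4 * Real.exp (-1 * B12Sec2to5.l1 x) := by gcongr
        _ = MQ 1 4 * E * Real.exp (-1 * B12Sec2to5.l1 x) := by ring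
    · intro P _ j _ s _ μ ν
      by_cases hμν : μ = ν
      · subst hμν
        exact ⟨fun _ _ => 0, fun x => rep537_diag _ μ x, fun w => expBound_zero _ _ (by positivity)⟩
      · obtain ⟨rem, hrep, hdec⟩ := rep537_toyKernel (d := 4) hμν (βt j (sectionHist S P j s)) (1 / 2)
        refine ⟨rem, hrep, fun w => (hdec w).mono ?_⟩
        show |βt j (sectionHist S P j s)| ≤ 1 * (b + 1)
        rw [one_mul]; exact (hsz j _).1
  -- the letters of the toy's β (= the bump family with χ = the smooth step)
  have hlo : BetaLowerH b γ S.β := betaLowerH_of_bumpFamily hβ hε0.le hMpos.le hχ01 γ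
  have hup : BetaUpperH (b + b) γ S.β := fun k v hv =>
    (betaUpperH_of_bumpFamily hβ hε0.le hMpos.le hχ01 γ k v hv).trans (by linarith)
  have hcont : BetaContH γ S.β := betaContH_of_bumpFamily (ε := ε) (M := M) hβ (smoothStep_continuous τ) γ
  have hpert : BetaPertH S.β b :=
    betaPertH_of_bumpFamily hβ hε0.le hMpos.le hχ01 hCp.le hA0 hγ
      (fun γ' _ hγ'τ j p hj hp => bump_zero_of_smallBox hM hMpos (twoThirds_runB hA hB hb.le hε0.le hx hΔ54 hγ'τ) (by omega) hp) hεA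
  -- the two runs ARE the setting's runs from their bare couplings (forward uniqueness)
  have hrgA : RGEqH (2 * n) βt gA := rgEqH_runA (ε := ε) (χ := fun s : ℝ => Real.smoothTransition (s / τ)) hβ hA hb.le hx hM hMpos
  have hrgB : RGEqH (2 * n) βt gB :=
    rgEqH_runB (ε := ε) (M := M) (χ := fun s : ℝ => Real.smoothTransition (s / τ)) hβ hB hb.le hε0.le hx fun j _ hj => hχB j hj.le
  have hboxes := runs_box hA hB hb.le hε0.le hx
  have hcA : ∀ k, k ≤ 2 * n → S.cpl ⟨2 * n, 0, gA 0⟩ k = gA k :=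
    fwd_eq_of_rgEqH (β := βt) (c := tbl (gA 0)) (hcs (gA 0)) rfl hrgA fun i hi => (hboxes.1 i hi).1
  have hcB : ∀ k, k ≤ 2 * n → S.cpl ⟨2 * n, 0, gB 0⟩ k = gB k :=
    fwd_eq_of_rgEqH (β := βt) (c := tbl (gB 0)) (hcs (gB 0)) rfl hrgB fun i hi => (hboxes.2 i hi).1
  have hrunA : RunHyp S ⟨2 * n, 0, gA 0⟩ := by
    refine ⟨fun k hk => ?_, fun k hk => ?_⟩
    · have hk' : k < 2 * n := hk
      have hpre : prefixOf (S.cpl ⟨2 * n, 0, gA 0⟩) k = prefixOf gA k := by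
        funext i; simp only [FlowStep.prefixOf_apply]; exact hcA i (by have := i.isLt; omega)
      rw [hcA k hk'.le, hcA (k + 1) hk', hpre]; exact hrgA k hk'
    · have hk' : k ≤ 2 * n := hk
      rw [hcA k hk']; exact ⟨(hboxes.1 k hk').1, (hboxes.1 k hk').2.trans (hend.le.trans hgγ)⟩
  have hrunB : RunHyp S ⟨2 * n, 0, gB 0⟩ := by
    refine ⟨fun k hk => ?_, fun k hk => ?_⟩
    · have hk' : k < 2 * n := hk
      have hpre : prefixOf (S.cpl ⟨2 * n, 0, gB 0⟩) k = prefixOf gB k := by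
        funext i; simp only [FlowStep.prefixOf_apply]; exact hcB i (by have := i.isLt; omega)
      rw [hcB k hk'.le, hcB (k + 1) hk', hpre]; exact hrgB k hk'
    · have hk' : k ≤ 2 * n := hk
      rw [hcB k hk']; exact ⟨(hboxes.2 k hk').1, (hboxes.2 k hk').2.trans (hend.le.trans hgγ)⟩
  refine ⟨S, hH, hD, hCo, rfl, theorem2Statement_of_letters hH hD hγ hb (by linarith) hcont hlo hup, hpert, hlo, hup, hcont,
    ⟨_, histLipschitz_of_bumpFamily hβ hε0.le hMpos hχ01 hχL, uniformModulus_of_bumpFamily hε0.le hMpos hL0 hεM hεL⟩,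
    2 * n, 0, gA 0, gB 0, (ne_of_lt (runs_start_lt hA hB hb.le hε0 hx hn1)).symm, hrunA, hrunB, ?_, ?_⟩
  · rw [hcA (2 * n) le_rfl]; exact hend
  · rw [hcB (2 * n) le_rfl, ← runs_end_eq hA hB]; exact hend

/-! ## §26 Headline -/

/-- **FADING MEMORY IS LOAD-BEARING FOR «g₀ = g₀(ε, g)» BEING A FUNCTION — ON THE CARRIER, WITH PRINT, THEOREM 2 AND THE WALL LETTER ADDED.**
#61e's `bareCoupling_unique_of_fadingMemory` with its fading-memory input (`FadingMemory C θ Λ`, 0 < θ < 1, C(γ³ + 2γ∕b) ≤ (1 − θ)∕2) replaced by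
the UNIFORM modulus `FadingMemory C 1 Λ` (NO smallness asked) is FALSE — and stays false when `StandingHypotheses ∧ Conclusions` (the whole
as-printed interface), `Theorem2Statement`, `BetaPertH S.β b`, `BetaUpperH`, (C) are ADDED to its hypotheses, for EVERY b > 0 and C > 0.  In the
history reading, uniqueness of the tuned bare coupling at every depth needs decay of the moduli in the age k − i (or Markov-type feedback);
[I] prints no modulus at all (p. 298; DELTA-I D-20). [cite: Balaban1987RG1, Thm 2 p.259 («g₀ = g₀(ε, g)») with (0.18)–(0.20) pp.255–256 and p.298] -/
theorem fadingMemory_loadBearing {b C : ℝ} (hb : 0 < b) (hC : 0 < C) :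
    ¬ (∀ (S : Setting), StandingHypotheses S → Definitions S → Conclusions S → (∀ hL, Theorem2Statement S hL) → BetaPertH S.β b →
        ∀ (γ : ℝ) (Λ : ℕ → ℕ → ℝ), 0 < γ → HistLipschitz Λ γ S.β → FadingMemory C 1 Λ → BetaLowerH b γ S.β →
        BetaUpperH (b + b) γ S.β → BetaContH γ S.β →
        ∀ (K m : ℕ) (g₀ g₀' : ℝ), RGEqH K S.β (S.cpl ⟨K, m, g₀⟩) → RGEqH K S.β (S.cpl ⟨K, m, g₀'⟩) →
          Step.InInterval γ K (S.cpl ⟨K, m, g₀⟩) → Step.InInterval γ K (S.cpl ⟨K, m, g₀'⟩) →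
          S.cpl ⟨K, m, g₀⟩ K = S.cpl ⟨K, m, g₀'⟩ K → g₀ = g₀') := by
  intro h
  obtain ⟨S, hH, hD, hCo, hγ, hT2, hpert, hlo, hup, hcont, ⟨Λ, hL, hΛ⟩, K, m, g₀, g₀', hne, hP, hP', hend, hend'⟩ :=
    nonuniqueToy_exists (γ := 1) (g := 1) hb hC hb one_pos one_pos le_rfl
  refine hne (h S hH hD hCo (fun _ => hT2) hpert 1 Λ one_pos hL hΛ hlo hup hcont K m g₀ g₀' hP.rg hP'.rg ?_ ?_ (hend.trans hend'.symm))
  · have := hP.inInterval; rwa [hγ] at this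
  · have := hP'.inInterval; rwa [hγ] at this

end

end Summit.QuantumFields.BalabanUV.Beta.EriceFlowEnclosureB12AsPrintedHistoryNonuniqueSetting
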